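import Summits.ResolutionOfSingularities.ResolutionOfSingularities.Theorems.SeparableGaloisGaloisQuotientModelsDefs
import Literature.AlgebraicGeometry.Resolution.GaloisAlterationSandwichBase
import Literature.AlgebraicGeometry.Resolution.SandwichModel
import Literature.AlgebraicGeometry.Resolution.RegularLocalRingsNormal
import Literature.AlgebraicGeometry.Resolution.AlterationsProofs
import HarnessLib

/-!
# Crux `GaloisQuotientModels` (stmt-ResolutionOfSingularities-18955), line `inseparability-foliation-quotient`:
# stub `stub_sandwichModel`

Route `ResolutionOfSingularities/SeparableGalois`; registered stub of the line skeleton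
`Cruxes/GaloisQuotientModels/Lines/inseparability_foliation_quotient.lean` (lead's reshape, 2026-08-17).
Vocabulary: `Theorems/SeparableGaloisGaloisQuotientModelsDefs.lean`.

**Statement.** For de Jong's Galois alteration datum of exponent `n` (`π : X₁ → X` a `G`-invariant
alteration from a regular integral `X₁` with faithful finite `G`, finite subsets of `X₁` in affine
opens) over a field `k` of characteristic `p`, with `X/k` separated of finite type and finite subsets
of `X` in affine opens, and with the Frobenius compositum `Mₙ = K·L^{pⁿ}` (`L = K(X₁)`,
`K = π^*K(X)`) stable under `G`, there is a NORMAL SANDWICH MODEL `X₁ —u→ Z —v→ X` of `Mₙ`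
(`IsSandwichModel`: `u` finite surjective equivariant, `v` invariant, `u ≫ v = π`, `u^*K(Z) = Mₙ`,
`Z` normal) with `Z` quasi-compact, `v` an alteration, finite subsets of `Z` in affine opens, and
`G → Aut Z` injective.

**Proof.** `Z := Spec_Y(f'_*𝒪_{X₁} ∩ Mₙ)` is the relative spectrum
(`Literature.AlgebraicGeometry.RelativeSpec.SubringSpec`, `…GermSubfieldSpec`) of the quasi-coherent
algebra of sections with generic germ in `Mₙ`, for the integral `G`-invariant structure map
`f' = (Frⁿ ≫ q, π) : X₁ → Y = (X₁/G) × X` (`q` the quotient by `G`, `Frⁿ` the `pⁿ`-power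
endomorphism; `Literature.AlgebraicGeometry.Resolution.exists_frobeniusTwistedBase`): its sections
have germs in `Mₙ` because `Spec L → Y` factors through `Spec Mₙ`. Then `u = toSpec` is finite
(integral: `Frⁿ` is; of finite type) and surjective, `v = fromSpec ≫ pr₂` gives `u ≫ v = π`, the
action descends through `(g⁻¹)^*` on the stable rings (`…SubringSpecAut`), `u^*K(Z) = Mₙ`, `Z` is
normal (localisations of `Γ ∩ Mₙ`, `Γ` integrally closed as `X₁` is regular), `v` is proper
(Artin–Tate) and generically finite (Zariski's Main Theorem), and faithfulness on `Z` follows from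
`Mₙ ⊇ L^{pⁿ}` (`Literature.AlgebraicGeometry.Resolution.exists_sandwichModel`).

Sources: A. J. de Jong, *Families of curves and alterations*, Ann. Inst. Fourier 47 (1997), 5.3 and
Thm. 5.13; Stacks Project 01LQ (relative spectrum); Mumford, *Abelian Varieties*, §7.
-/

noncomputable section

-- single-problem summit: the doubled namespace component `ResolutionOfSingularities` is forced
set_option linter.dupNamespace false

open CategoryTheory AlgebraicGeometry TopologicalSpace
open Literature.AlgebraicGeometry.Resolution
open Literature.AlgebraicGeometry.Motives Literature.AlgebraicGeometry.Motives.RatFn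

namespace Summit.ResolutionOfSingularities.ResolutionOfSingularities.Theorems.GaloisQuotientModels

/-- **The normal sandwich model of level `n`** (de Jong's infinitesimal quotient): for a de Jong
datum `(ρ, π)` of exponent `n` over a field of characteristic `p` with `X/k` separated of finite
type, finite subsets of `X` in affine opens, and `Mₙ = K·L^{pⁿ}` stable under `G`, there is an
integral normal `Z` with a faithful `G`-action, `u : X₁ → Z` finite surjective equivariant and
`v : Z → X` an invariant alteration with `u ≫ v = π` and `u^* K(Z) = Mₙ`; `Z` is quasi-compact and
its finite subsets lie in affine opens. Proof: `Z = Spec_Y(f'_*𝒪_{X₁} ∩ Mₙ)` for the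
Frobenius-twisted base `f' : X₁ → (X₁/G) × X`
(`Literature.AlgebraicGeometry.Resolution.exists_frobeniusTwistedBase`,
`Literature.AlgebraicGeometry.Resolution.exists_sandwichModel`).
[cite: DeJong1997, 5.3 and Thm. 5.13] -/
theorem stub_sandwichModel (p n : ℕ) [Fact p.Prime] (k : Type) [Field k] [CharP k p]
    (X : Scheme.{0}) [IsIntegral X] (f : X ⟶ Spec (.of k)) [IsSeparated f] [LocallyOfFiniteType f]
    [QuasiCompact f] (hXaff : ∀ S : Finset X, ∃ U : X.Opens, IsAffineOpen U ∧ (↑S : Set X) ⊆ U)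
    (G : Type) [Group G] [Finite G] (X₁ : Scheme.{0}) [IsIntegral X₁]
    (ρ : G →* Aut X₁) (π : X₁ ⟶ X) [IsDominant π] (hGA : IsGaloisAlterationOfExponent p n ρ π)
    (hstab : ∀ (g : G) (a : X₁.functionField), a ∈ frobeniusCompositum π p n →
      functionFieldMap (ρ g).hom a ∈ frobeniusCompositum π p n) :
    ∃ (Z : Scheme.{0}) (_ : IsIntegral Z) (ρZ : G →* Aut Z) (u : X₁ ⟶ Z) (_ : IsDominant u)
      (v : Z ⟶ X), IsSandwichModel p n ρ π ρZ u v ∧ CompactSpace Z ∧ IsAlteration v ∧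
      (∀ S : Finset Z, ∃ U : Z.Opens, IsAffineOpen U ∧ (↑S : Set Z) ⊆ U) ∧
      Function.Injective ρZ := by
  classical
  have hp : p.Prime := Fact.out
  haveI := hGA.isAlteration.isProper
  -- the Frobenius-twisted base `f' : X₁ → Y = (X₁/G) × X`
  obtain ⟨Y, f', hf'int, hf'lft, v₀, hv₀, hfac, hinvf', happ, hYaff⟩ :=
    exists_frobeniusTwistedBase p n f hXaff ρ π hGA.comp_eq hGA.exists_isAffineOpen
  haveI := hf'int
  haveI := hf'lft
  haveI := hv₀
  -- the remaining hypotheses of the sandwich construction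
  haveI : CharP X₁.functionField p := by
    haveI : Nonempty (⊤ : X₁.Opens) := ⟨⟨genericPoint X₁, trivial⟩⟩
    exact (((X₁.germToFunctionField ⊤).hom.comp
      (((π ≫ f).appTop).hom.comp (Scheme.ΓSpecIso (.of k)).inv.hom)).charP_iff_charP p).mp
      inferInstance
  haveI : ExpChar X₁.functionField p := ExpChar.prime hp
  haveI : CompactSpace X₁ := QuasiCompact.compactSpace_of_compactSpace (π ≫ f)
  haveI : IsLocallyNoetherian X := LocallyOfFiniteType.isLocallyNoetherian f
  have hnorm : ∀ x : X₁, IsIntegrallyClosed (X₁.presheaf.stalk x) := fun x ↦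
    haveI := hGA.isRegular x
    isIntegrallyClosed_of_isRegularLocalRing _
  have hρ : ∀ g : G, (ρ g).hom = 𝟙 X₁ → g = 1 := fun g hg ↦
    hGA.injective (by rw [map_one]; exact Iso.ext hg)
  obtain ⟨Z, hZ, ρZ, u, hu, v, hcomm, hinvv, hfac', hfin, hsurj, hrange, hnormZ, hcpt, hprop,
      hfinv, hZaff, hinj⟩ :=
    exists_sandwichModel (frobeniusCompositum π p n) happ ρ hρ v₀ π hfac hinvf' hstab p n rfl
      hnorm hYaff hGA.isAlteration.exists_isFinite
  haveI := hZ
  haveI := hu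
  haveI : IsDominant v := isDominant_of_comp_eq u v π hfac'
  exact ⟨Z, hZ, ρZ, u, hu, v, ⟨hcomm, hinvv, hfac', hfin, hsurj, hrange, hnormZ⟩, hcpt,
    ⟨hZ, hprop, inferInstance, hfinv⟩, hZaff, hinj⟩

end Summit.ResolutionOfSingularities.ResolutionOfSingularities.Theorems.GaloisQuotientModels

end
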